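import Literature.Computability.AlgebraicComplexity.GenericStabilizerCountingCoreFour
import Mathlib.RingTheory.Polynomial.Basic
import HarnessLib

/-!
# Counting core for the generic trivial stabiliser — the case `D = 3` (`m ≥ 4`), and the dispatcher

Topic `Literature/Computability/AlgebraicComplexity`; theorems only. Third file of Brick C
(val-lit-p4 g5) of x3 g3's programme for the typed fact `BI2017_matsumuraMonsky_trivialStabilizer`
(Bürgisser–Ikenmeyer 2017 §2.1: "if `D > 2` and `m > 3`, then almost all `w ∈ Sym^D ℂ^m` have a
trivial stabilizer" — Matsumura–Monsky 1964), after `GenericStabilizerCountingCore.lean` (`D ≥ 5`) and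
`GenericStabilizerCountingCoreFour.lean` (`D = 4`):

* `core_three` — for `m ≥ 4` and non-constant `c : [m] → K`:
  `#{e ⊢ 3 : c^e = 1} + #{(i,j) : c_i ≠ c_j} + 1 ≤ #{e ⊢ 3}`;
* `card_invMonomials_add_card_lt` — THE DISPATCHER over the whole range of the typed fact
  (`3 ≤ D`, `4 ≤ m`): `#invMonomials D c + #{(i,j) : c_i ≠ c_j} < #degMonomials (Fin m) D`, the
  hypothesis of the dimension-count criterion `isZariskiGeneric_not_mem_chartImage`
  (`FormChartDimensionCount.lean`) with `card_chartVars` (`StabilizerEigenbasisCharts.lean`).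

The charge for `D = 3`: `(i,j) ↦ x_i x_j^2` if bad; otherwise `c_i c_j^2 = 1`, whence `c_j^3 ≠ 1` and
all such partners `i` of `j` share the value `c_j^{-2}`; with `a₀(j)` the least of them,
`(a₀(j), j) ↦ x_j^3` and `(i, j) ↦ x_i x_{a₀(j)} x_j` (`i ≠ a₀(j)`; value `c_j^{-3} ≠ 1`). Injectivity by
the patterns `(1,2) / (3) / (1,1,1)` — in the last class `j` is recovered as the letter whose value
differs from the other two. The left-over bad monomial is found by cases: a bad cube without good
partner; else, if all cubes are good, `x_a x_b x_d` with `c_a = c_b ≠ c_d` (there are at most three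
cube roots of unity and `m ≥ 4`); else for a bad cube `x_l^3` with a good partner: `x_{l'} x_l^2` for
a second index of value `c_l`, or `x_a x_{a'} x_l` for two non-least good partners, or
`x_l x_{a₀(l)} x_d` with `d` outside (three pairwise distinct values). For `(D, m) = (3, 3)` the
inequality is FALSE (`c = (1, 1, -1)`: the elliptic involution), matching the typed `m > 3`.

HONEST FRAMING: elementary counting inside a classical genericity theorem, filed as literature
bookkeeping; VP ≠ VNP is NOT proved and nothing in this file is progress on it.
[cite: BurgisserIkenmeyer2017, §2.1 (before Thm. 2.3)]
-/

noncomputable section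

open scoped BigOperators

namespace Literature.Computability.AlgebraicComplexity

namespace TrivialStabilizerCount

open scoped Classical

variable {K : Type*} [Field K] {m : ℕ}

/-! ### Pattern lemmas (degree `3`) -/

/-- Evaluation of `x_i x_a x_j` (distinct letters): `1` on the three letters, `0` elsewhere.
[cite: BurgisserIkenmeyer2017, §2.1 (generic stabilizer; Matsumura–Monsky)] -/
theorem one_one_one_apply {i a j : Fin m} (hia : i ≠ a) (hij : i ≠ j) (haj : a ≠ j) (t : Fin m) :
    (Finsupp.single i 1 + Finsupp.single a 1 + Finsupp.single j 1 : Fin m →₀ ℕ) t =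
      if t = i ∨ t = a ∨ t = j then 1 else 0 := by
  rw [three_apply]
  by_cases hi : t = i
  · subst hi
    rw [if_pos rfl, if_neg (Ne.symm hia), if_neg (Ne.symm hij), if_pos (Or.inl rfl)]
  by_cases ha : t = a
  · subst ha
    rw [if_neg hia, if_pos rfl, if_neg (Ne.symm haj), if_pos (Or.inr (Or.inl rfl))]
  by_cases hj : t = j
  · subst hj
    rw [if_neg hij, if_neg haj, if_pos rfl, if_pos (Or.inr (Or.inr rfl))]
  rw [if_neg (Ne.symm hi), if_neg (Ne.symm ha), if_neg (Ne.symm hj), if_neg]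
  rintro (h | h | h)
  · exact hi h
  · exact ha h
  · exact hj h

/-- Two all-ones three-letter monomials coincide only if the second letter set is contained in the
first. [cite: BurgisserIkenmeyer2017, §2.1 (generic stabilizer; Matsumura–Monsky)] -/
theorem mem_of_one_one_one_eq {i a j i' a' j' : Fin m} (hia : i ≠ a) (hij : i ≠ j) (haj : a ≠ j)
    (hia' : i' ≠ a') (hij' : i' ≠ j') (haj' : a' ≠ j')
    (h : Finsupp.single i 1 + Finsupp.single a 1 + Finsupp.single j 1 =
      Finsupp.single i' 1 + Finsupp.single a' 1 + Finsupp.single j' 1) (t : Fin m)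
    (ht : t = i' ∨ t = a' ∨ t = j') : t = i ∨ t = a ∨ t = j := by
  have h1 := DFunLike.congr_fun h t
  rw [one_one_one_apply hia hij haj, one_one_one_apply hia' hij' haj', if_pos ht] at h1
  by_contra hn
  rw [if_neg hn] at h1
  exact zero_ne_one h1

/-- `x_i x_j^2 ≠` an all-ones three-letter monomial. [cite: BurgisserIkenmeyer2017, §2.1 (generic stabilizer; Matsumura–Monsky)] -/
theorem one_two_ne_one_one_one {i j i' a' j' : Fin m} (hia' : i' ≠ a') (hij' : i' ≠ j')
    (haj' : a' ≠ j') :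
    Finsupp.single i 1 + Finsupp.single j 2 ≠ Finsupp.single i' 1 + Finsupp.single a' 1 + Finsupp.single j' 1 := by
  refine two_ne_of_three_pos hia' haj' hij' ?_ ?_ ?_ <;> rw [one_one_one_apply hia' hij' haj'] <;> simp

/-! ### Values -/

/-- If `c_a c_j^2 = 1` and `c_a ≠ c_j` then `c_j^3 ≠ 1`. [cite: BurgisserIkenmeyer2017, §2.1 (generic stabilizer; Matsumura–Monsky)] -/
theorem pow_three_ne_one_of_good {c : Fin m → K} {a j : Fin m} (hne : c a ≠ c j)
    (h : c a * c j ^ 2 = 1) : c j ^ 3 ≠ 1 := by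
  intro h3
  apply hne
  have hj0 : c j ^ 2 ≠ 0 := by
    intro h0; rw [h0, mul_zero] at h; exact zero_ne_one h
  have : c a * c j ^ 2 = c j * c j ^ 2 := by
    rw [h]
    calc (1 : K) = c j ^ 3 := h3.symm
      _ = c j * c j ^ 2 := by ring
  exact mul_right_cancel₀ hj0 this

/-- In a field there are at most three cube roots of unity: among four or more indices two carry the
same value if all values are cube roots of unity. [cite: BurgisserIkenmeyer2017, §2.1 (generic stabilizer; Matsumura–Monsky)] -/
theorem exists_ne_apply_eq_of_pow_three (hm : 4 ≤ m) (c : Fin m → K) (h3 : ∀ i, c i ^ 3 = 1) :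
    ∃ a b : Fin m, a ≠ b ∧ c a = c b := by
  have hmaps : ∀ i ∈ (Finset.univ : Finset (Fin m)),
      c i ∈ (Polynomial.nthRoots 3 (1 : K)).toFinset := fun i _ => by
    rw [Multiset.mem_toFinset, Polynomial.mem_nthRoots (by norm_num : 0 < 3)]
    exact h3 i
  have hcard : (Polynomial.nthRoots 3 (1 : K)).toFinset.card < (Finset.univ : Finset (Fin m)).card := by
    calc (Polynomial.nthRoots 3 (1 : K)).toFinset.card ≤ (Polynomial.nthRoots 3 (1 : K)).card :=
          Multiset.toFinset_card_le _
      _ ≤ 3 := Polynomial.card_nthRoots 3 1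
      _ < (Finset.univ : Finset (Fin m)).card := by rw [Finset.card_univ, Fintype.card_fin]; omega
  obtain ⟨a, -, b, -, hab, h⟩ := Finset.exists_ne_map_eq_of_card_lt_of_maps_to hcard hmaps
  exact ⟨a, b, hab, h⟩

/-! ### The case `D = 3`, `m ≥ 4` -/

/-- **Counting core, `D = 3`, `m ≥ 4`.** For a non-constant `c : [m] → K`,
`#{e ⊢ 3 : c^e = 1} + #{(i,j) : c_i ≠ c_j} + 1 ≤ #{e ⊢ 3}`. The cross pair `(i,j)` is charged to
`x_i x_j^2` if bad; otherwise `c_i c_j^2 = 1` (so `c_j^3 ≠ 1` and `c_i = c_j^{-2}`), and writing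
`a₀(j)` for the least such partner of `j`, the pair `(a₀(j), j)` is charged to `x_j^3` and `(i, j)`,
`i ≠ a₀(j)`, to the bad all-ones monomial `x_i x_{a₀(j)} x_j` (value `c_j^{-3}`). A left-over bad
monomial: `x_l^3` with `c_l^3 ≠ 1` and no good partner; or, when every `c_l^3 = 1`, a monomial
`x_a x_b x_d` with `c_a = c_b ≠ c_d` (two of `m ≥ 4` indices share one of the `≤ 3` cube roots of unity);
or `x_{l'} x_l^2` with `c_{l'} = c_l`, `c_l^3 ≠ 1`; or `x_a x_{a'} x_l` for two non-least good partners of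
`l`; or `x_l x_{a₀(l)} x_d` with `d` outside (three distinct values). This is where `m ≥ 4` (the typed
`m > 3`) is used; `(D, m) = (3, 3)` is false (ternary cubics, `c = (1, 1, -1)`).
[cite: BurgisserIkenmeyer2017, §2.1 (generic stabilizer; Matsumura–Monsky)] -/
theorem core_three (hm : 4 ≤ m) (c : Fin m → K) (hnc : ∃ i j, c i ≠ c j) :
    ((degMonomials (Fin m) 3).filter fun e => ∏ t, c t ^ e t = 1).card +
      (Finset.univ.filter fun p : Fin m × Fin m => c p.1 ≠ c p.2).card + 1 ≤
        (degMonomials (Fin m) 3).card := by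
  -- the charge
  let A : Fin m × Fin m → (Fin m →₀ ℕ) := fun p => Finsupp.single p.1 1 + Finsupp.single p.2 2
  let gd : (Fin m →₀ ℕ) → Prop := fun e => ∏ t, c t ^ e t = 1
  let U : Fin m → Finset (Fin m) := fun j => Finset.univ.filter fun a => c a ≠ c j ∧ gd (A (a, j))
  let a₀ : Fin m → Fin m := fun j => if h : (U j).Nonempty then (U j).min' h else j
  let Q : Fin m × Fin m → (Fin m →₀ ℕ) := fun p =>
    Finsupp.single p.1 1 + Finsupp.single (a₀ p.2) 1 + Finsupp.single p.2 1
  let Ψ : Fin m × Fin m → (Fin m →₀ ℕ) := fun p =>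
    if ¬ gd (A p) then A p else if p.1 = a₀ p.2 then Finsupp.single p.2 3 else Q p
  -- values
  have hA' : ∀ p : Fin m × Fin m, gd (A p) ↔ c p.1 * c p.2 ^ 2 = 1 := by
    intro p
    show (∏ t, c t ^ ((Finsupp.single p.1 1 + Finsupp.single p.2 2 : Fin m →₀ ℕ) t)) = 1 ↔ _
    rw [prod_pow_two, pow_one]
  have hS : ∀ a : Fin m, (∏ t, c t ^ (Finsupp.single a 3 : Fin m →₀ ℕ) t) = c a ^ 3 := fun a =>
    prod_pow_single_apply c a 3
  have hQv : ∀ p : Fin m × Fin m, (∏ t, c t ^ Q p t) = c p.1 ^ 1 * c (a₀ p.2) ^ 1 * c p.2 ^ 1 := by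
    intro p
    show ∏ t, c t ^ ((Finsupp.single p.1 1 + Finsupp.single (a₀ p.2) 1 + Finsupp.single p.2 1 :
      Fin m →₀ ℕ) t) = _
    rw [prod_pow_three]
  have hU : ∀ j a : Fin m, a ∈ U j ↔ c a ≠ c j ∧ gd (A (a, j)) := fun j a => by
    show a ∈ Finset.univ.filter _ ↔ _
    rw [Finset.mem_filter]
    simp only [Finset.mem_univ, true_and]
  -- the data of a good cross pair
  have hgood : ∀ p : Fin m × Fin m, c p.1 ≠ c p.2 → gd (A p) →
      a₀ p.2 ∈ U p.2 ∧ a₀ p.2 ≤ p.1 ∧ c (a₀ p.2) ≠ c p.2 ∧ c (a₀ p.2) * c p.2 ^ 2 = 1 ∧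
        c p.1 * c p.2 ^ 2 = 1 ∧ c p.1 = c (a₀ p.2) ∧ c p.2 ^ 3 ≠ 1 ∧ a₀ p.2 ≠ p.2 ∧ p.1 ≠ p.2 := by
    intro p hp h
    have hmem : p.1 ∈ U p.2 := (hU p.2 p.1).mpr ⟨hp, h⟩
    have hne : (U p.2).Nonempty := ⟨p.1, hmem⟩
    have ha₀ : a₀ p.2 = (U p.2).min' hne := by
      show (if h : (U p.2).Nonempty then (U p.2).min' h else p.2) = _
      rw [dif_pos hne]
    have ha₀mem : a₀ p.2 ∈ U p.2 := by rw [ha₀]; exact Finset.min'_mem _ _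
    obtain ⟨hca, hga⟩ := (hU p.2 _).mp ha₀mem
    rw [hA'] at hga
    have hgp : c p.1 * c p.2 ^ 2 = 1 := (hA' p).mp h
    have hc0 : c p.2 ^ 2 ≠ 0 := by
      intro h0; rw [h0, mul_zero] at hgp; exact zero_ne_one hgp
    refine ⟨ha₀mem, by rw [ha₀]; exact Finset.min'_le _ _ hmem, hca, hga, hgp,
      mul_right_cancel₀ hc0 (hgp.trans hga.symm), pow_three_ne_one_of_good hp hgp,
      fun h => hca (by rw [h]), fun h => hp (by rw [h])⟩
  -- the three branches of `Ψ`
  have hΨA : ∀ p, ¬ gd (A p) → Ψ p = A p := fun p h => by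
    show (if ¬ gd (A p) then A p else _) = _
    rw [if_pos h]
  have hΨP : ∀ p, gd (A p) → p.1 = a₀ p.2 → Ψ p = Finsupp.single p.2 3 := fun p h1 h2 => by
    show (if ¬ gd (A p) then A p else if p.1 = a₀ p.2 then Finsupp.single p.2 3 else Q p) = _
    rw [if_neg (not_not.mpr h1), if_pos h2]
  have hΨQ : ∀ p, gd (A p) → p.1 ≠ a₀ p.2 → Ψ p = Q p := fun p h1 h2 => by
    show (if ¬ gd (A p) then A p else if p.1 = a₀ p.2 then Finsupp.single p.2 3 else Q p) = _
    rw [if_neg (not_not.mpr h1), if_neg h2]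
  -- positivity of the letters of `Q p`
  have hQpos : ∀ p : Fin m × Fin m, p.1 ≠ a₀ p.2 → p.1 ≠ p.2 → a₀ p.2 ≠ p.2 →
      0 < Q p p.1 ∧ 0 < Q p (a₀ p.2) ∧ 0 < Q p p.2 := by
    intro p h1 h2 h3
    show 0 < (Finsupp.single p.1 1 + Finsupp.single (a₀ p.2) 1 + Finsupp.single p.2 1 : Fin m →₀ ℕ) p.1 ∧
      0 < (Finsupp.single p.1 1 + Finsupp.single (a₀ p.2) 1 + Finsupp.single p.2 1 : Fin m →₀ ℕ) (a₀ p.2) ∧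
      0 < (Finsupp.single p.1 1 + Finsupp.single (a₀ p.2) 1 + Finsupp.single p.2 1 : Fin m →₀ ℕ) p.2
    refine ⟨?_, ?_, ?_⟩ <;> rw [one_one_one_apply h1 h2 h3] <;> simp
  -- degree, badness, injectivity of the charge
  have hΨdeg : ∀ p : Fin m × Fin m, c p.1 ≠ c p.2 → Ψ p ∈ degMonomials (Fin m) 3 := by
    intro p hp
    by_cases h1 : gd (A p)
    · by_cases h2 : p.1 = a₀ p.2
      · rw [hΨP p h1 h2, mem_degMonomials_iff, Finsupp.degree_single]
      · rw [hΨQ p h1 h2]; exact single_add_single_add_single_mem _ _ _ rfl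
    · rw [hΨA p h1]; exact single_add_single_mem _ _ rfl
  have hΨbad : ∀ p : Fin m × Fin m, c p.1 ≠ c p.2 → ¬ gd (Ψ p) := by
    intro p hp
    by_cases h1 : gd (A p)
    · obtain ⟨-, -, -, hga, hgp, -, h3, -, -⟩ := hgood p hp h1
      by_cases h2 : p.1 = a₀ p.2
      · rw [hΨP p h1 h2]
        show ¬ (∏ t, c t ^ (Finsupp.single p.2 3 : Fin m →₀ ℕ) t) = 1
        rw [hS]; exact h3
      · rw [hΨQ p h1 h2]
        intro hq
        apply h3
        have hval : c p.1 ^ 1 * c (a₀ p.2) ^ 1 * c p.2 ^ 1 = 1 := by rw [← hQv]; exact hq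
        calc c p.2 ^ 3 = c p.1 ^ 1 * c (a₀ p.2) ^ 1 * c p.2 ^ 1 * c p.2 ^ 3 := by rw [hval, one_mul]
          _ = (c p.1 * c p.2 ^ 2) * (c (a₀ p.2) * c p.2 ^ 2) := by ring
          _ = 1 := by rw [hgp, hga, one_mul]
    · rw [hΨA p h1]; exact h1
  have hΨinj : Set.InjOn Ψ {p : Fin m × Fin m | c p.1 ≠ c p.2} := by
    intro p hp q hq hΨ
    have hp' : p.1 ≠ p.2 := fun h => hp (by rw [h])
    have hq' : q.1 ≠ q.2 := fun h => hq (by rw [h])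
    by_cases hp1 : gd (A p) <;> by_cases hq1 : gd (A q)
    · obtain ⟨-, -, hpca, -, -, hpc1, -, hpa2, -⟩ := hgood p hp hp1
      obtain ⟨-, -, hqca, -, -, hqc1, -, hqa2, -⟩ := hgood q hq hq1
      by_cases hp2 : p.1 = a₀ p.2 <;> by_cases hq2 : q.1 = a₀ q.2
      · rw [hΨP p hp1 hp2, hΨP q hq1 hq2] at hΨ
        have h2 : p.2 = q.2 := (Finsupp.single_left_inj (by norm_num)).mp hΨ
        refine Prod.ext ?_ h2
        rw [hp2, hq2, h2]
      · exfalso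
        rw [hΨP p hp1 hp2, hΨQ q hq1 hq2] at hΨ
        have hpos := hQpos q hq2 hq' hqa2
        exact single_ne_of_three_pos hq2 hqa2 hq' hpos.1 hpos.2.1 hpos.2.2 hΨ
      · exfalso
        rw [hΨQ p hp1 hp2, hΨP q hq1 hq2] at hΨ
        have hpos := hQpos p hp2 hp' hpa2
        exact single_ne_of_three_pos hp2 hpa2 hp' hpos.1 hpos.2.1 hpos.2.2 hΨ.symm
      · -- Q = Q
        rw [hΨQ p hp1 hp2, hΨQ q hq1 hq2] at hΨ
        have hΨ' : Finsupp.single p.1 1 + Finsupp.single (a₀ p.2) 1 + Finsupp.single p.2 1 =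
            Finsupp.single q.1 1 + Finsupp.single (a₀ q.2) 1 + Finsupp.single q.2 1 := hΨ
        have memL := mem_of_one_one_one_eq hp2 hp' hpa2 hq2 hq' hqa2 hΨ'
        have memR := mem_of_one_one_one_eq hq2 hq' hqa2 hp2 hp' hpa2 hΨ'.symm
        -- `q.2 = p.2`: the letter with the odd value
        have h2 : q.2 = p.2 := by
          rcases memL q.2 (Or.inr (Or.inr rfl)) with h | h | h
          · -- q.2 = p.1: then {q.1, a₀ q.2} = {a₀ p.2, p.2}, equal values: contradiction
            exfalso
            rcases memL q.1 (Or.inl rfl) with h1 | h1 | h1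
            · exact hq' (h1.trans h.symm)
            · rcases memL (a₀ q.2) (Or.inr (Or.inl rfl)) with h3 | h3 | h3
              · exact hqa2 (h3.trans h.symm)
              · exact hq2 (h1.trans h3.symm)
              · exact hpca (by rw [← h1, hqc1, h3])
            · rcases memL (a₀ q.2) (Or.inr (Or.inl rfl)) with h3 | h3 | h3
              · exact hqa2 (h3.trans h.symm)
              · exact hpca (by rw [← h3, ← hqc1, h1])
              · exact hq2 (h1.trans h3.symm)
          · exfalso
            rcases memL q.1 (Or.inl rfl) with h1 | h1 | h1
            · rcases memL (a₀ q.2) (Or.inr (Or.inl rfl)) with h3 | h3 | h3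
              · exact hq2 (h1.trans h3.symm)
              · exact hqa2 (h3.trans h.symm)
              · -- values: c q.1 = c (a₀ q.2) gives c p.1 = c p.2
                exact hp (by rw [← h1, hqc1, h3])
            · exact hq' (h1.trans h.symm)
            · rcases memL (a₀ q.2) (Or.inr (Or.inl rfl)) with h3 | h3 | h3
              · exact hp (by rw [← h3, ← hqc1, h1])
              · exact hqa2 (h3.trans h.symm)
              · exact hq2 (h1.trans h3.symm)
          · exact h
        have ha : a₀ q.2 = a₀ p.2 := by rw [h2]
        have h1 : q.1 = p.1 := by
          rcases memL q.1 (Or.inl rfl) with h | h | h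
          · exact h
          · exact absurd (h.trans ha.symm) hq2
          · exact absurd (h.trans h2.symm) hq'
        exact Prod.ext h1.symm h2.symm
    · exfalso
      rw [hΨA q hq1] at hΨ
      by_cases hp2 : p.1 = a₀ p.2
      · rw [hΨP p hp1 hp2] at hΨ
        exact two_ne_single hq' (by norm_num) (by norm_num) hΨ.symm
      · obtain ⟨-, -, -, -, -, -, -, hpa2, -⟩ := hgood p hp hp1
        rw [hΨQ p hp1 hp2] at hΨ
        exact one_two_ne_one_one_one hp2 hp' hpa2 hΨ.symm
    · exfalso
      rw [hΨA p hp1] at hΨ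
      by_cases hq2 : q.1 = a₀ q.2
      · rw [hΨP q hq1 hq2] at hΨ
        exact two_ne_single hp' (by norm_num) (by norm_num) hΨ
      · obtain ⟨-, -, -, -, -, -, -, hqa2, -⟩ := hgood q hq hq1
        rw [hΨQ q hq1 hq2] at hΨ
        exact one_two_ne_one_one_one hq2 hq' hqa2 hΨ
    · rw [hΨA p hp1, hΨA q hq1] at hΨ
      obtain ⟨ha, hb⟩ := eq_of_two_eq_two hp' (by norm_num) (by norm_num) (by norm_num) hΨ
      exact Prod.ext ha.symm hb.symm
  -- the left-over monomial, by cases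
  by_cases hc1 : ∃ l, c l ^ 3 ≠ 1 ∧ ¬ (U l).Nonempty
  · -- a bad cube with no good partner
    obtain ⟨l, hl3, hlU⟩ := hc1
    refine core_of_injection 3 c Ψ (Finsupp.single l 3) (by rw [mem_degMonomials_iff, Finsupp.degree_single])
      (by rw [hS]; exact hl3) hΨdeg hΨbad (fun p hp => ?_) hΨinj
    by_cases h1 : gd (A p)
    · by_cases h2 : p.1 = a₀ p.2
      · rw [hΨP p h1 h2]
        intro h
        have : p.2 = l := (Finsupp.single_left_inj (by norm_num)).mp h
        obtain ⟨hmem, -⟩ := hgood p hp h1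
        exact hlU ⟨_, this ▸ hmem⟩
      · obtain ⟨-, -, -, -, -, -, -, hpa2, hp'⟩ := hgood p hp h1
        rw [hΨQ p h1 h2]
        have hpos := hQpos p h2 hp' hpa2
        exact (single_ne_of_three_pos h2 hpa2 hp' hpos.1 hpos.2.1 hpos.2.2).symm
    · rw [hΨA p h1]
      exact two_ne_single (fun h => hp (by rw [h])) (by norm_num) (by norm_num)
  push Not at hc1
  -- hc1 : ∀ l, c l ^ 3 ≠ 1 → (U l).Nonempty
  by_cases hc2 : ∀ l, c l ^ 3 = 1
  · -- all cubes good: every cross `x_i x_j^2` is bad, and `x_a x_b x_d` with `c_a = c_b ≠ c_d` is left over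
    obtain ⟨a, b, hab, hcab⟩ := exists_ne_apply_eq_of_pow_three hm c hc2
    obtain ⟨d, hd⟩ : ∃ d, c d ≠ c a := by
      by_contra h
      push Not at h
      obtain ⟨i, j, hij⟩ := hnc
      exact hij ((h i).trans (h j).symm)
    have had : a ≠ d := fun h => hd (by rw [h])
    have hbd : b ≠ d := fun h => hd (by rw [← h, hcab])
    have hallA : ∀ p : Fin m × Fin m, c p.1 ≠ c p.2 → ¬ gd (A p) := by
      intro p hp h
      obtain ⟨-, -, -, -, -, -, h3, -, -⟩ := hgood p hp h
      exact h3 (hc2 p.2)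
    refine core_of_injection 3 c Ψ (Finsupp.single a 1 + Finsupp.single b 1 + Finsupp.single d 1)
      (single_add_single_add_single_mem _ _ _ rfl) ?_ hΨdeg hΨbad (fun p hp => ?_) hΨinj
    · show ¬ (∏ t, c t ^ ((Finsupp.single a 1 + Finsupp.single b 1 + Finsupp.single d 1 :
        Fin m →₀ ℕ) t)) = 1
      rw [prod_pow_three]
      intro h
      apply hd
      have hb0 : c b ^ 2 ≠ 0 := pow_ne_zero _ (fun h0 => by
        rw [h0, zero_pow one_ne_zero, mul_zero, zero_mul] at h; exact zero_ne_one h)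
      have : c d ^ 1 * c b ^ 2 = c a ^ 1 * c b ^ 2 := by
        calc c d ^ 1 * c b ^ 2 = c a ^ 1 * c b ^ 1 * c d ^ 1 := by rw [hcab]; ring
          _ = 1 := h
          _ = c b ^ 3 := (hc2 b).symm
          _ = c a ^ 1 * c b ^ 2 := by rw [hcab]; ring
      simpa using mul_right_cancel₀ hb0 this
    · rw [hΨA p (hallA p hp)]
      refine two_ne_of_three_pos hab hbd had ?_ ?_ ?_ <;> rw [one_one_one_apply hab had hbd] <;> simp
  push Not at hc2
  obtain ⟨l, hl3⟩ := hc2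
  have hUl : (U l).Nonempty := hc1 l hl3
  -- the least good partner of `l` and its data (through a cross pair `(a, l)`)
  obtain ⟨a1, ha1⟩ := hUl
  obtain ⟨hca1, hga1⟩ := (hU l a1).mp ha1
  obtain ⟨ha₀mem, -, hca₀, hga₀, -, -, -, ha₀l, -⟩ := hgood (a1, l) hca1 hga1
  change a₀ l ∈ U l at ha₀mem
  change c (a₀ l) ≠ c l at hca₀
  change c (a₀ l) * c l ^ 2 = 1 at hga₀
  change a₀ l ≠ l at ha₀l
  by_cases hc3 : ∃ l', l' ≠ l ∧ c l' = c l
  · -- a same-value partner: `x_{l'} x_l^2` is bad and never charged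
    obtain ⟨l', hl'l, hcl'⟩ := hc3
    refine core_of_injection 3 c Ψ (Finsupp.single l' 1 + Finsupp.single l 2)
      (single_add_single_mem _ _ rfl) ?_ hΨdeg hΨbad (fun p hp => ?_) hΨinj
    · show ¬ (∏ t, c t ^ ((Finsupp.single l' 1 + Finsupp.single l 2 : Fin m →₀ ℕ) t)) = 1
      rw [prod_pow_two, hcl']
      intro h; apply hl3
      calc c l ^ 3 = c l ^ 1 * c l ^ 2 := by ring
        _ = 1 := h
    · by_cases h1 : gd (A p)
      · by_cases h2 : p.1 = a₀ p.2
        · rw [hΨP p h1 h2]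
          exact (two_ne_single hl'l (by norm_num) (by norm_num)).symm
        · obtain ⟨-, -, -, -, -, -, -, hpa2, hp'⟩ := hgood p hp h1
          rw [hΨQ p h1 h2]
          exact (one_two_ne_one_one_one h2 hp' hpa2).symm
      · rw [hΨA p h1]
        intro h
        obtain ⟨h1', h2'⟩ := eq_of_two_eq_two (fun h' => hp (by rw [h'])) (by norm_num) (by norm_num)
          (by norm_num) h
        exact hp (by rw [← h1', ← h2', hcl'])
  push Not at hc3
  -- `l` is alone in its value class
  by_cases hc4 : ∃ a a', a ∈ U l ∧ a' ∈ U l ∧ a ≠ a' ∧ a ≠ a₀ l ∧ a' ≠ a₀ l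
  · obtain ⟨a, a', haU, ha'U, haa', haa₀, ha'a₀⟩ := hc4
    obtain ⟨hca, hga⟩ := (hU l a).mp haU
    obtain ⟨hca', hga'⟩ := (hU l a').mp ha'U
    rw [hA'] at hga hga'
    have hal : a ≠ l := fun h => hca (by rw [h])
    have ha'l : a' ≠ l := fun h => hca' (by rw [h])
    have hcaa' : c a = c a' := by
      have hc0 : c l ^ 2 ≠ 0 := by
        intro h0; rw [h0, mul_zero] at hga; exact zero_ne_one hga
      exact mul_right_cancel₀ hc0 (hga.trans hga'.symm)
    refine core_of_injection 3 c Ψ (Finsupp.single a 1 + Finsupp.single a' 1 + Finsupp.single l 1)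
      (single_add_single_add_single_mem _ _ _ rfl) ?_ hΨdeg hΨbad (fun p hp => ?_) hΨinj
    · show ¬ (∏ t, c t ^ ((Finsupp.single a 1 + Finsupp.single a' 1 + Finsupp.single l 1 :
        Fin m →₀ ℕ) t)) = 1
      rw [prod_pow_three]
      intro h
      apply hl3
      calc c l ^ 3 = c a ^ 1 * c a' ^ 1 * c l ^ 1 * c l ^ 3 := by rw [h, one_mul]
        _ = (c a * c l ^ 2) * (c a' * c l ^ 2) := by ring
        _ = 1 := by rw [hga, hga', one_mul]
    · by_cases h1 : gd (A p)
      · by_cases h2 : p.1 = a₀ p.2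
        · rw [hΨP p h1 h2]
          refine single_ne_of_three_pos haa' ha'l hal ?_ ?_ ?_ <;>
            rw [one_one_one_apply haa' hal ha'l] <;> simp
        · obtain ⟨-, -, hpca, -, -, hpc1, -, hpa2, hp'⟩ := hgood p hp h1
          rw [hΨQ p h1 h2]
          intro h
          have h' : Finsupp.single p.1 1 + Finsupp.single (a₀ p.2) 1 + Finsupp.single p.2 1 =
              Finsupp.single a 1 + Finsupp.single a' 1 + Finsupp.single l 1 := h
          have memL := mem_of_one_one_one_eq h2 hp' hpa2 haa' hal ha'l h'
          have memR := mem_of_one_one_one_eq haa' hal ha'l h2 hp' hpa2 h'.symm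
          -- `p.2` must be `l` (the odd value), then `a₀ l ∈ {a, a'}`: contradiction
          rcases memL l (Or.inr (Or.inr rfl)) with h3 | h3 | h3
          · -- l = p.1: then a, a' ∈ {a₀ p.2, p.2} with c a = c a' but c (a₀ p.2) ≠ c p.2
            rcases memL a (Or.inl rfl) with h4 | h4 | h4
            · exact hal (h4.trans h3.symm)
            · rcases memL a' (Or.inr (Or.inl rfl)) with h5 | h5 | h5
              · exact ha'l (h5.trans h3.symm)
              · exact haa' (h4.trans h5.symm)
              · exact hpca (by rw [← h4, hcaa', h5])
            · rcases memL a' (Or.inr (Or.inl rfl)) with h5 | h5 | h5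
              · exact ha'l (h5.trans h3.symm)
              · exact hpca (by rw [← h5, ← hcaa', h4])
              · exact haa' (h4.trans h5.symm)
          · rcases memL a (Or.inl rfl) with h4 | h4 | h4
            · rcases memL a' (Or.inr (Or.inl rfl)) with h5 | h5 | h5
              · exact haa' (h4.trans h5.symm)
              · exact ha'l (h5.trans h3.symm)
              · exact hp (by rw [← h4, hcaa', h5])
            · exact hal (h4.trans h3.symm)
            · rcases memL a' (Or.inr (Or.inl rfl)) with h5 | h5 | h5
              · exact hp (by rw [← h5, ← hcaa', h4])
              · exact ha'l (h5.trans h3.symm)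
              · exact haa' (h4.trans h5.symm)
          · -- l = p.2
            have ha₀ : a₀ p.2 = a₀ l := by rw [h3]
            rcases memR (a₀ p.2) (Or.inr (Or.inl rfl)) with h4 | h4 | h4
            · exact haa₀ (h4.symm.trans ha₀)
            · exact ha'a₀ (h4.symm.trans ha₀)
            · exact hpa2 (h4.trans h3)
      · rw [hΨA p h1]
        exact one_two_ne_one_one_one haa' hal ha'l
  push Not at hc4
  -- at most one good partner besides `a₀ l`: a fourth index `d` outside
  have hsmall : ((U l).erase (a₀ l)).card ≤ 1 := by
    by_contra h
    push Not at h
    obtain ⟨a, ha, a', ha', hne⟩ := Finset.one_lt_card.mp h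
    rw [Finset.mem_erase] at ha ha'
    exact ha'.1 (hc4 a a' ha.2 ha'.2 hne ha.1)
  have hUcard : (U l).card ≤ 2 := by
    have := Finset.card_erase_add_one ha₀mem
    omega
  obtain ⟨d, hdU, hdl⟩ : ∃ d, d ∉ U l ∧ d ≠ l := by
    by_contra h
    push Not at h
    have hsub : (Finset.univ : Finset (Fin m)) ⊆ insert l (U l) := fun d _ => by
      by_cases hd : d = l
      · rw [hd]; exact Finset.mem_insert_self _ _
      · exact Finset.mem_insert_of_mem (by by_contra hn; exact hd (h d hn))
    have := (Finset.card_le_card hsub).trans (Finset.card_insert_le _ _)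
    rw [Finset.card_univ, Fintype.card_fin] at this
    omega
  have hcd : c d ≠ c l := fun h => hc3 d hdl h
  have hcd' : c d * c l ^ 2 ≠ 1 := by
    intro h
    exact hdU ((hU l d).mpr ⟨hcd, (hA' (d, l)).mpr h⟩)
  have hda₀ : d ≠ a₀ l := fun h => hdU (h ▸ ha₀mem)
  refine core_of_injection 3 c Ψ (Finsupp.single l 1 + Finsupp.single (a₀ l) 1 + Finsupp.single d 1)
    (single_add_single_add_single_mem _ _ _ rfl) ?_ hΨdeg hΨbad (fun p hp => ?_) hΨinj
  · show ¬ (∏ t, c t ^ ((Finsupp.single l 1 + Finsupp.single (a₀ l) 1 + Finsupp.single d 1 :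
      Fin m →₀ ℕ) t)) = 1
    rw [prod_pow_three]
    intro h
    apply hcd
    calc c d = c d * (c (a₀ l) * c l ^ 2) := by rw [hga₀, mul_one]
      _ = c l ^ 1 * c (a₀ l) ^ 1 * c d ^ 1 * c l := by ring
      _ = c l := by rw [h, one_mul]
  · by_cases h1 : gd (A p)
    · by_cases h2 : p.1 = a₀ p.2
      · rw [hΨP p h1 h2]
        refine single_ne_of_three_pos (Ne.symm ha₀l) hda₀.symm hdl.symm ?_ ?_ ?_ <;>
          rw [one_one_one_apply (Ne.symm ha₀l) hdl.symm hda₀.symm] <;> simp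
      · obtain ⟨-, -, hpca, -, -, hpc1, -, hpa2, hp'⟩ := hgood p hp h1
        rw [hΨQ p h1 h2]
        intro h
        have h' : Finsupp.single p.1 1 + Finsupp.single (a₀ p.2) 1 + Finsupp.single p.2 1 =
            Finsupp.single l 1 + Finsupp.single (a₀ l) 1 + Finsupp.single d 1 := h
        have memR := mem_of_one_one_one_eq (Ne.symm ha₀l) hdl.symm hda₀.symm h2 hp' hpa2 h'.symm
        -- `p.1` and `a₀ p.2` have the same value, but `c l`, `c (a₀ l)`, `c d` are pairwise distinct
        have hvals : ∀ t, (t = l ∨ t = a₀ l ∨ t = d) → ∀ t', (t' = l ∨ t' = a₀ l ∨ t' = d) →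
            c t = c t' → t = t' := by
          have hcda₀ : c d ≠ c (a₀ l) := by
            intro h
            exact hcd' (by rw [h, hga₀])
          rintro t (rfl | rfl | rfl) t' (rfl | rfl | rfl) htt' <;>
            first | rfl | exact absurd htt' hca₀.symm | exact absurd htt' hca₀ |
              exact absurd htt' hcd.symm | exact absurd htt' hcd | exact absurd htt' hcda₀.symm |
              exact absurd htt' hcda₀
        exact h2 (hvals p.1 (memR p.1 (Or.inl rfl)) (a₀ p.2) (memR (a₀ p.2) (Or.inr (Or.inl rfl))) hpc1)
    · rw [hΨA p h1]
      exact one_two_ne_one_one_one (Ne.symm ha₀l) hdl.symm hda₀.symm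

/-! ### Dispatcher: all `D ≥ 3`, `m ≥ 4` -/

/-- **Counting core for the whole range of the typed fact** (`D > 2`, `m > 3`): for non-constant `c`,
`#invMonomials D c + #{(i,j) : c_i ≠ c_j} < #degMonomials (Fin m) D` — the hypothesis of
`isZariskiGeneric_not_mem_chartImage` (FormChartDimensionCount) with `card_chartVars`
(StabilizerEigenbasisCharts). [cite: BurgisserIkenmeyer2017, §2.1 ("almost all w ∈ Sym^D ℂ^m have a trivial stabilizer")] -/
theorem card_invMonomials_add_card_lt {D : ℕ} (hD : 3 ≤ D) (hm : 4 ≤ m) (c : Fin m → K)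
    (hnc : ∃ i j, c i ≠ c j) :
    (invMonomials D c).card + (Finset.univ.filter fun q : Fin m × Fin m => c q.1 ≠ c q.2).card <
      (degMonomials (Fin m) D).card := by
  rcases Nat.lt_or_ge D 5 with hlt | hge
  · interval_cases D
    · rw [invMonomials_eq_filter]
      have := core_three hm c hnc
      omega
    · exact card_invMonomials_add_card_lt_four (by omega) c hnc
  · exact card_invMonomials_add_card_lt_of_five_le hge (by omega) c hnc

end TrivialStabilizerCount

end Literature.Computability.AlgebraicComplexity

end
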